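import Mathlib
import HarnessLib
import Literature.Probability.MarkovChains.RandomTargetLemma
import Literature.Probability.MarkovChains.SpectralRepresentation
import Literature.Probability.MarkovChains.AsymptoticVarianceSpectral
import Literature.Probability.MarkovChains.CountingBound

/-!
# Spectral formula for the target time: `t_⊙ = Σ_{j ≥ 2} (1 − λ_j)⁻¹` (Levin–Peres–Wilmer Lemma 12.17)

HONEST FRAMING: exact (Metropolis-corrected) sampling algorithms for lattice gauge theory; figures
of merit are autocorrelation/cost numbers at stated couplings and volumes; no continuum-physics claim.

Source: D. A. Levin, Y. Peres (with E. L. Wilmer), *Markov Chains and Mixing Times*, 2nd ed.,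
AMS 2017 [LevinPeres2017], §12.5 "Spectral Formula for the Target Time", LEMMA 12.17 (Random Target
Lemma for Reversible Chains), p. 172.  Conventions of `RandomTargetLemma.lean` (`IsHittingTimeSolution
P h`: the first-step equations of `h(a,x) = E_a(τ_x)`; `targetTime π h a = Σ_x E_a(τ_x)π(x) = t_⊙`,
Lemma 10.1), `SpectralRepresentation.lean` (Lemma 12.2: the `⟨·,·⟩_π`-orthonormal eigenfunctions
`specFun hA j = f_j` with eigenvalues `specVal hA j = λ_j` of a reversible `P`, indexed by `X`; the
`λ = 1` eigenfunctions are constant on an irreducible chain) and `PeskunOrdering.lean` (the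
fundamental matrix `Z = (I − P + Π)⁻¹`, `fundamentalMatrix`, with `isUnit_fundamentalInv`,
`fundamentalMatrix_poisson`, `fundamentalMatrix_mulVec_const`) and `AsymptoticVarianceSpectral.lean`
(`fundamentalMatrix_mulVec_specFun`).  Everything is PROVED (0 named facts, no new definitions).

* `fundamentalMatrix_sub_mulVec_col` — `Z(a,x) − (PZ)(a,x) = 1{a = x} − π(x)`, i.e.
  `(I − P)Z = I − Π` (from `fundamentalMatrix_poisson` and `Z1 = 1`) [cite: Peskun1973, §2.1
  Definition 2.1.1];
* `isHittingTimeSolution_fundamental` / `IsHittingTimeSolution.eq_fundamental` — **`E_a(τ_x) =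
  [Z(x,x) − Z(a,x)]/π(x)`**: the fundamental-matrix expression solves the first-step equations, hence
  IS the hitting-time matrix by uniqueness (`RandomTargetLemma.lean`) [cite: LevinPeres2017, §10.2
  eq. (10.3)] — the classical Kemeny–Snell formula, used here in place of the book's Prop. 10.26;
* `targetTime_eq_sum_fundamental` — `t_⊙ = Σ_x Z(x,x) − 1` (rows of `Z` sum to `1`);
* `fundamentalMatrix_apply_eq_sum` — `Z(x,y) = π(y) Σ_j (Zf_j)(x) f_j(y)` (Lemma 12.2's completeness
  relation), with `Z f_j = (1 − λ_j)⁻¹ f_j` for `λ_j ≠ 1` (`fundamentalMatrix_mulVec_specFun` of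
  `AsymptoticVarianceSpectral.lean`, reused) and `Z f_j = f_j` for `λ_j = 1`
  (`fundamentalMatrix_mulVec_specFun_of_eq_one`);
* `LevinPeres2017_prop_10_26_fundamental` — **Prop. 10.26 in fundamental-matrix form**:
  `π(x)E_π(τ_x) = Z(x,x) − π(x)` (the book's series `Σ_t [Pᵗ(x,x) − π(x)]` evaluated as `Z − Π` on
  the diagonal; the series itself is not formalised) [cite: LevinPeres2017, §10.7 Prop. 10.26 eq. (10.38)];
* **LEMMA 12.17** `LevinPeres2017_lemma_12_17`: for an irreducible reversible chain,
  `t_⊙ = Σ_{j : λ_j ≠ 1} 1/(1 − λ_j)` — the book's `Σ_{i=2}^{n}` written, as in the tree's eq. (12.2)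
  (`LevinPeres2017_eq_12_2`), as the sum over the eigen-indices with `λ_j ≠ 1` (for an irreducible
  chain exactly one index carries `λ = 1`).  DECLARED DEVIATION: the book sums the series
  `Σ_t [Pᵗ(x,x) − π(x)] = π(x)E_π(τ_x)` (Prop. 10.26) against the spectral decomposition (12.2); here
  the same bookkeeping is done on the fundamental matrix `Z = (I − P + Π)⁻¹` (finite algebra, valid
  also for periodic chains where the series diverges): `t_⊙ = Σ_x [Z(x,x) − Z(a,x)]` and
  `Z f_j = (1 − λ_j)⁻¹ f_j`. [cite: LevinPeres2017, §12.5 Lemma 12.17]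

Context (cell pub-lqcd): the eigentime identity links the target (average hitting) time of a reversible
sampler to its whole spectrum, complementing `t_rel = 1/γ` (RelaxationTime.lean): `t_⊙ ≥ t_rel − 1`
type comparisons and spectral diagnostics of slow sector-to-sector movement.
-/

namespace Literature.Probability.MarkovChains

open Finset Matrix

variable {X : Type*} [Fintype X] [DecidableEq X] {P : Matrix X X ℝ} {π : X → ℝ}

/-! ## The fundamental matrix and hitting times -/

/-- `(I − P) Z = I − Π` entrywise: `Z(a,x) − Σ_y P(a,y) Z(y,x) = 1{a = x} − π(x)` (the Poisson equation
`fundamentalMatrix_poisson` for the centred datum `1_x − π(x)`, using `Z1 = 1`).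
[cite: Peskun1973, §2.1 Definition 2.1.1 (`Z = (I − (P − A))⁻¹`)] -/
theorem fundamentalMatrix_sub_mulVec_col (hP : IsRowStochastic P) (hπ1 : ∑ x, π x = 1)
    (hst : IsStationary π P) (hirr : IsIrreducible P) (a x : X) :
    fundamentalMatrix π P a x - ∑ y, P a y * fundamentalMatrix π P y x =
      (if a = x then 1 else 0) - π x := by
  have hK := isUnit_fundamentalInv hπ1 hP hst hirr
  set g : X → ℝ := fun y => (if y = x then 1 else 0) - π x with hg
  have hgc : ∑ y, π y * g y = 0 := by
    simp only [hg, mul_sub, sum_sub_distrib, mul_ite, mul_one, mul_zero, sum_ite_eq' univ x,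
      if_pos (mem_univ x), ← sum_mul, hπ1, one_mul, sub_self]
  -- `Z g = Z(·, x) − π(x)·1`
  have hZg : ∀ b, (fundamentalMatrix π P *ᵥ g) b = fundamentalMatrix π P b x - π x := by
    intro b
    have h1 : g = (fun y => if y = x then (1 : ℝ) else 0) - fun _ => π x := by
      funext y; simp [hg]
    rw [h1, mulVec_sub, fundamentalMatrix_mulVec_const hP hπ1 hK, Pi.sub_apply]
    congr 1
    simp [mulVec, dotProduct]
  have hZg' : fundamentalMatrix π P *ᵥ g = fun b => fundamentalMatrix π P b x - π x := funext hZg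
  have hpois := congrFun (fundamentalMatrix_poisson hπ1 hst hK hgc) a
  rw [hZg', Pi.sub_apply] at hpois
  simp only [mulVec, dotProduct] at hpois
  have h2 : ∑ y, P a y * (fundamentalMatrix π P y x - π x) =
      ∑ y, P a y * fundamentalMatrix π P y x - π x := by
    rw [show (∑ y, P a y * (fundamentalMatrix π P y x - π x)) =
        ∑ y, P a y * fundamentalMatrix π P y x - ∑ y, P a y * π x by
      rw [← sum_sub_distrib]; exact sum_congr rfl fun y _ => by ring]
    rw [← sum_mul, hP.2 a, one_mul]
  rw [h2] at hpois
  have hga : g a = (if a = x then 1 else 0) - π x := rfl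
  linarith

/-- **The fundamental-matrix formula for hitting times**: `h(a,x) := [Z(x,x) − Z(a,x)]/π(x)` solves
the first-step equations `h(x,x) = 0`, `h(a,x) = 1 + Σ_y P(a,y)h(y,x)` (`a ≠ x`) — hence, by
uniqueness (`IsHittingTimeSolution.unique`), `E_a(τ_x) = [Z(x,x) − Z(a,x)]/π(x)`.
[cite: LevinPeres2017, §10.2 eq. (10.3) (first-step equations)] [cite: Peskun1973, §2.1 (the
fundamental matrix after Kemeny–Snell)] -/
theorem isHittingTimeSolution_fundamental (hP : IsRowStochastic P) (hπ : ∀ x, 0 < π x)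
    (hπ1 : ∑ x, π x = 1) (hst : IsStationary π P) (hirr : IsIrreducible P) :
    IsHittingTimeSolution P fun a x =>
      (fundamentalMatrix π P x x - fundamentalMatrix π P a x) / π x := by
  refine ⟨fun x => by simp, fun a x hax => ?_⟩
  have hπx := (hπ x).ne'
  have hcol := fundamentalMatrix_sub_mulVec_col hP hπ1 hst hirr a x
  rw [if_neg hax, zero_sub] at hcol
  have h1 : ∑ y, P a y * ((fundamentalMatrix π P x x - fundamentalMatrix π P y x) / π x) =
      (fundamentalMatrix π P x x - ∑ y, P a y * fundamentalMatrix π P y x) / π x := by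
    rw [eq_div_iff hπx, sum_mul]
    have h3 : ∀ y, P a y * ((fundamentalMatrix π P x x - fundamentalMatrix π P y x) / π x) * π x =
        P a y * fundamentalMatrix π P x x - P a y * fundamentalMatrix π P y x := by
      intro y
      field_simp
    simp_rw [h3]
    rw [sum_sub_distrib, ← sum_mul, hP.2 a, one_mul]
  have h2 : ∑ y, P a y * fundamentalMatrix π P y x = fundamentalMatrix π P a x + π x := by
    linarith
  show (fundamentalMatrix π P x x - fundamentalMatrix π P a x) / π x =
    1 + ∑ y, P a y * ((fundamentalMatrix π P x x - fundamentalMatrix π P y x) / π x)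
  rw [h1, h2]
  field_simp
  ring

/-- **`E_a(τ_x) = [Z(x,x) − Z(a,x)]/π(x)`** for the hitting-time matrix of an irreducible chain with
stationary `π > 0`. [cite: LevinPeres2017, §10.2 eq. (10.3)] [cite: Peskun1973, §2.1] -/
theorem IsHittingTimeSolution.eq_fundamental (hP : IsRowStochastic P) (hπ : ∀ x, 0 < π x)
    (hπ1 : ∑ x, π x = 1) (hst : IsStationary π P) (hirr : IsIrreducible P) {h : X → X → ℝ}
    (hh : IsHittingTimeSolution P h) (a x : X) :
    h a x = (fundamentalMatrix π P x x - fundamentalMatrix π P a x) / π x := by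
  have := hh.unique hP hirr (isHittingTimeSolution_fundamental hP hπ hπ1 hst hirr)
  exact congrFun (congrFun this a) x

/-- **`t_⊙ = Σ_x [Z(x,x) − Z(a,x)] = tr Z − 1`** (rows of `Z` sum to `1`). [cite: LevinPeres2017,
§10.2 Lemma 10.1 (`t_⊙` does not depend on `a`)] [cite: Peskun1973, §2.1] -/
theorem targetTime_eq_sum_fundamental (hP : IsRowStochastic P) (hπ : ∀ x, 0 < π x)
    (hπ1 : ∑ x, π x = 1) (hst : IsStationary π P) (hirr : IsIrreducible P) {h : X → X → ℝ}
    (hh : IsHittingTimeSolution P h) (a : X) :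
    targetTime π h a = ∑ x, fundamentalMatrix π P x x - 1 := by
  have hK := isUnit_fundamentalInv hπ1 hP hst hirr
  have hrow : ∑ x, fundamentalMatrix π P a x = 1 := by
    have := congrFun (fundamentalMatrix_mulVec_const hP hπ1 hK 1) a
    simpa [mulVec, dotProduct] using this
  rw [targetTime_def, ← hrow, ← sum_sub_distrib]
  refine sum_congr rfl fun x _ => ?_
  rw [hh.eq_fundamental hP hπ hπ1 hst hirr a x, div_mul_cancel₀ _ (hπ x).ne']

/-! ## The fundamental matrix in the eigenbasis of a reversible chain -/

/-- **`Z f_j = f_j` for `λ_j = 1`** (such `f_j` are constant on an irreducible chain, and `Z1 = 1`).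
[cite: LevinPeres2017, §12.1 Lemma 12.2 (iii) (`f_1 = 1`)] [cite: Peskun1973, §2.3 (`Z1 = 1`)] -/
theorem fundamentalMatrix_mulVec_specFun_of_eq_one (hP : IsRowStochastic P) (hπ : ∀ x, 0 < π x)
    (hπ1 : ∑ x, π x = 1) (hDB : DetailedBalance π P) (hirr : IsIrreducible P)
    (hA : (symmMatrix π P).IsHermitian) {j : X} (hj : specVal hA j = 1) (a : X) :
    fundamentalMatrix π P *ᵥ specFun hA j = specFun hA j := by
  have hst : IsStationary π P := hDB.isStationary hP.2
  have hK := isUnit_fundamentalInv hπ1 hP hst hirr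
  have hconst : specFun hA j = fun _ => specFun hA j a :=
    funext fun x => specFun_apply_eq_of_specVal_eq_one hπ hP hirr hA hj x a
  rw [hconst]
  exact fundamentalMatrix_mulVec_const hP hπ1 hK _

/-- **`Z(x,y) = π(y) Σ_j (Z f_j)(x) f_j(y)`** — the kernel of `Z` in the orthonormal eigenbasis (the
completeness relation `1{w = y} = π(y) Σ_j f_j(w) f_j(y)`, Lemma 12.2 (ii) at `t = 0`).
[cite: LevinPeres2017, §12.1 Lemma 12.2 (ii), eq. (12.4)] -/
theorem fundamentalMatrix_apply_eq_sum (hπ : ∀ x, 0 < π x) (hA : (symmMatrix π P).IsHermitian)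
    (x y : X) :
    fundamentalMatrix π P x y =
      π y * ∑ j, (fundamentalMatrix π P *ᵥ specFun hA j) x * specFun hA j y := by
  have hδ : ∀ w, (if y = w then (1 : ℝ) else 0) = ∑ j, specFun hA j w * specFun hA j y * π y := by
    intro w
    have h := LevinPeres2017_lemma_12_2 hπ hA 0 w y
    simp_rw [pow_zero, mul_one] at h
    rw [kernelAt_zero_apply] at h
    exact h
  have step : fundamentalMatrix π P x y =
      ∑ w, fundamentalMatrix π P x w * (if y = w then 1 else 0) := by
    simp only [mul_ite, mul_one, mul_zero]
    rw [sum_ite_eq univ y]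
    simp
  rw [step]
  simp_rw [hδ, mul_sum]
  rw [sum_comm]
  refine sum_congr rfl fun j _ => ?_
  simp only [mulVec, dotProduct]
  rw [sum_mul, mul_sum]
  exact sum_congr rfl fun w _ => by ring

/-! ## Lemma 12.17 -/

/-- **LEMMA 12.17 (Random Target Lemma for Reversible Chains): for an irreducible reversible Markov
chain `t_⊙ = Σ_{j : λ_j ≠ 1} (1 − λ_j)⁻¹`.**  [cite: LevinPeres2017, §12.5 Lemma 12.17]  Proof (finite
fundamental-matrix version of the book's spectral bookkeeping, see the module docstring):
`t_⊙ = Σ_x [Z(x,x) − Z(a,x)] = Σ_j [⟨Zf_j, f_j⟩_π − (Zf_j)(a)·E_π f_j]`; an index with `λ_j ≠ 1` gives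
`(1 − λ_j)⁻¹ − 0`, an index with `λ_j = 1` (constant `f_j ≡ c`, `c² = 1`) gives `c² − c² = 0`. -/
theorem LevinPeres2017_lemma_12_17 (hP : IsRowStochastic P) (hπ : ∀ x, 0 < π x)
    (hπ1 : ∑ x, π x = 1) (hDB : DetailedBalance π P) (hirr : IsIrreducible P)
    (hA : (symmMatrix π P).IsHermitian) {h : X → X → ℝ} (hh : IsHittingTimeSolution P h) (a : X) :
    targetTime π h a = ∑ j ∈ univ.filter (fun j => specVal hA j ≠ 1), (1 - specVal hA j)⁻¹ := by
  have hst : IsStationary π P := hDB.isStationary hP.2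
  have hK := isUnit_fundamentalInv hπ1 hP hst hirr
  -- `t_⊙ = Σ_x Z(x,x) − Σ_x Z(a,x)`
  have hrow : ∑ x, fundamentalMatrix π P a x = 1 := by
    have := congrFun (fundamentalMatrix_mulVec_const hP hπ1 hK 1) a
    simpa [mulVec, dotProduct] using this
  have ht : targetTime π h a = ∑ x, fundamentalMatrix π P x x - ∑ x, fundamentalMatrix π P a x := by
    rw [targetTime_eq_sum_fundamental hP hπ hπ1 hst hirr hh a, hrow]
  -- expand both sums in the eigenbasis
  have hdiag : ∑ x, fundamentalMatrix π P x x = ∑ j, ∑ x, π x * (fundamentalMatrix π P *ᵥ specFun hA j) x * specFun hA j x := by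
    rw [sum_comm]
    refine sum_congr rfl fun x _ => ?_
    rw [fundamentalMatrix_apply_eq_sum hπ hA x x, mul_sum]
    exact sum_congr rfl fun j _ => by ring
  have hrowexp : ∑ x, fundamentalMatrix π P a x = ∑ j, (fundamentalMatrix π P *ᵥ specFun hA j) a * ∑ x, π x * specFun hA j x := by
    simp_rw [mul_sum]
    rw [sum_comm]
    refine sum_congr rfl fun x _ => ?_
    rw [fundamentalMatrix_apply_eq_sum hπ hA a x, mul_sum]
    exact sum_congr rfl fun j _ => by ring
  rw [ht, hdiag, hrowexp, ← sum_sub_distrib]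
  -- evaluate index by index
  rw [← sum_filter_add_sum_filter_not univ (fun j => specVal hA j ≠ 1)]
  have hone : ∑ j ∈ univ.filter (fun j => ¬ specVal hA j ≠ 1),
      (∑ x, π x * (fundamentalMatrix π P *ᵥ specFun hA j) x * specFun hA j x -
        (fundamentalMatrix π P *ᵥ specFun hA j) a * ∑ x, π x * specFun hA j x) = 0 := by
    refine sum_eq_zero fun j hj => ?_
    have hj' : specVal hA j = 1 := not_not.1 (mem_filter.1 hj).2
    rw [fundamentalMatrix_mulVec_specFun_of_eq_one hP hπ hπ1 hDB hirr hA hj' a]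
    have hconst : ∀ x, specFun hA j x = specFun hA j a :=
      fun x => specFun_apply_eq_of_specVal_eq_one hπ hP hirr hA hj' x a
    simp_rw [hconst]
    rw [← sum_mul, ← sum_mul, hπ1]
    ring
  rw [hone, add_zero]
  refine sum_congr rfl fun j hj => ?_
  have hj' : specVal hA j ≠ 1 := (mem_filter.1 hj).2
  rw [fundamentalMatrix_mulVec_specFun hπ hπ1 hP hDB hirr hA hj',
    sum_mul_eq_zero_of_mulVec_eq_smul hst (mulVec_specFun hπ hA j) hj', mul_zero, sub_zero]
  have hnorm := piInner_specFun hπ hA j j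
  rw [if_pos rfl, piInner] at hnorm
  simp_rw [Pi.smul_apply, smul_eq_mul]
  calc ∑ x, π x * ((1 - specVal hA j)⁻¹ * specFun hA j x) * specFun hA j x
      = (1 - specVal hA j)⁻¹ * ∑ x, π x * (specFun hA j x * specFun hA j x) := by
        rw [mul_sum]; exact sum_congr rfl fun x _ => by ring
    _ = (1 - specVal hA j)⁻¹ := by rw [hnorm, mul_one]

/-! ## Proposition 10.26 in fundamental-matrix form: `π(x) E_π(τ_x) = Z(x,x) − π(x)` -/

/-- `πZ = π` (since `π(I − P + Π) = π − π + π = π` and `(I − P + Π)Z = I`). [cite: Peskun1973, §2.1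
Definition 2.1.1] -/
theorem vecMul_fundamentalMatrix_eq (hP : IsRowStochastic P) (hπ1 : ∑ x, π x = 1)
    (hst : IsStationary π P) (hirr : IsIrreducible P) :
    π ᵥ* fundamentalMatrix π P = π := by
  have hK := isUnit_fundamentalInv hπ1 hP hst hirr
  have h1 : π ᵥ* (1 - (P - limitMatrix π)) = π := by
    funext y
    rw [vecMul_sub, vecMul_sub, vecMul_one, Pi.sub_apply, Pi.sub_apply]
    have hP' : (π ᵥ* P) y = π y := by
      rw [vecMul, dotProduct]; exact hst y
    have hA : (π ᵥ* limitMatrix π) y = π y := by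
      simp only [vecMul, dotProduct, limitMatrix, of_apply]
      rw [← sum_mul, hπ1, one_mul]
    rw [hP', hA]
    ring
  calc π ᵥ* fundamentalMatrix π P = (π ᵥ* (1 - (P - limitMatrix π))) ᵥ* fundamentalMatrix π P := by
        rw [h1]
    _ = π := by rw [vecMul_vecMul, fundamentalInv_mul_fundamentalMatrix hK, vecMul_one]

/-- **PROPOSITION 10.26, fundamental-matrix form: `π(x) E_π(τ_x) = Z(x,x) − π(x)`**, i.e.
`Σ_a π(a) E_a(τ_x) = [Z(x,x) − π(x)]/π(x)` — the book's `Σ_{t≥0} [Pᵗ(x,x) − π(x)] = π(x)E_π(τ_x)`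
with the series replaced by its finite-algebra value `Z(x,x) − π(x)` (`Z = (I − P + Π)⁻¹ = I +
Σ_{t≥1}(Pᵗ − Π)` for aperiodic chains; the series itself is not formalised here).
[cite: LevinPeres2017, §10.7 Prop. 10.26, eq. (10.38) (as used in §12.5, proof of Lemma 12.17)] [cite: Peskun1973,
§2.1] -/
theorem LevinPeres2017_prop_10_26_fundamental (hP : IsRowStochastic P) (hπ : ∀ x, 0 < π x)
    (hπ1 : ∑ x, π x = 1) (hst : IsStationary π P) (hirr : IsIrreducible P) {h : X → X → ℝ}
    (hh : IsHittingTimeSolution P h) (x : X) :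
    π x * ∑ a, π a * h a x = fundamentalMatrix π P x x - π x := by
  have hπZ : ∑ a, π a * fundamentalMatrix π P a x = π x := by
    have := congrFun (vecMul_fundamentalMatrix_eq hP hπ1 hst hirr) x
    rw [vecMul, dotProduct] at this
    exact this
  have hterm : ∀ a, π a * h a x =
      (π a * fundamentalMatrix π P x x - π a * fundamentalMatrix π P a x) / π x := by
    intro a
    rw [hh.eq_fundamental hP hπ hπ1 hst hirr a x]
    ring
  simp_rw [hterm]
  rw [← sum_div, sum_sub_distrib, ← sum_mul, hπ1, one_mul, hπZ, mul_div_cancel₀ _ (hπ x).ne']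

end Literature.Probability.MarkovChains
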